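import Literature.MathematicalPhysics.QuantumFieldTheory.Balaban1983to89.B2Ineq339RegularFieldConcrete

/-!
# `Balaban1983to89.B2Ineq339RegularFieldModuli` — [Balaban1982Higgs2] §3.B p. 591 with p. 586 (3.15)–(3.16): **(3.39) AT A REGULAR
NON-ZERO `Ã^ε` WITH THE ERROR DENSITY COUNTED FROM PRINTED-SHAPE MODULI** (companion of `B2Ineq339RegularFieldConcrete`, this seat,
gen 7): the exponent bookkeeping that turns the error of the restricted Proposition 3.1 (p23's `prop31_regular_concrete`:
`64γ₀d³e²(Lᵏδ_k)²Ψ_k²(Lᵏε)^d|Λ_k|`) into the printed `exp(O(1)Σ|Λ_k|)` of (3.39), GIVEN the regularity modulus `δ_k` of `Ã^ε` in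
the (1.21)/(2.2) shape and the sup-bound `Ψ_k` in the (3.15) shape — r14's count of cell GAPS G-B2-07 (ix) made a theorem: the
product `e²(Lᵏδ_k)²·Ψ_k²(Lᵏε)^d = O(1)e²λ^{−1/2}p(Lᵏε)⁴(Lᵏε)^{2−d/2}` is UNIFORMLY BOUNDED for `d ≤ 3` because the half power
`(Lᵏε)^{1/2} ≤ (Lᵏε)^{2−d/2}` absorbs the polylogarithm `p(Lᵏε)⁴` (`pFn_pow_four_mul_sqrt_le`)

statement-level skeleton of published theorems with citation tags; proofs where landed; nothing here is a claim about the Yang–Mills mass gap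

CITATION HEADER.  T. Bałaban, *(Higgs)₂,₃ quantum fields in a finite volume. II. An upper bound*, Commun. Math. Phys. **86**
(1982) 555–594 [Balaban1982Higgs2] (cell paper B2; PDF held `paper:balaban1982-cmp86-higgs23-ii`, journal page = PDF page + 554;
p. 557 (definition of `p(ε) = b₀(1 + log ε⁻¹)ᵖ, p > 2`), p. 586 (3.15)–(3.16) and p. 591 (3.39) read this gen on the text layer
`p0003.txt`/`p0032.txt`/`p0037.txt` and as images `…/1982-cmp86-higgs23-II-p032-x2.png`); T. Bałaban, *Regularity and decay of
lattice Green's functions*, Commun. Math. Phys. **89** (1983) 571–597 [Balaban1983RegularityDecay] ((1.21)–(1.22) p. 574).  Unit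
`lit-balaban-p15` gen 7 (Phase-2 proof seat p15; HOME `run/shared/lean/pub/lit-balaban/`).  SKELETON rows **B2.Eq3.32** (member
(3.39)) and **B2.Prop3.1** (fold owner r02, second reader r14, referee ref-4); cell GAPS **G-B2-07 (ix)** (r14 g10, 2026-08-21) and
pub-balaban GAPS **G-pv07-1 (ii)**.  USED BY NAME (nothing restated): `B2Ineq339RegularFieldConcrete.ineq339_regular` and everything
it quantifies over; `B2.pFn`; `B2Prop31ZeroFieldConcrete.mesh_le_mesh`.

THE SOURCE TEXT (verbatim).  p. 586: *"Because the fields A_l, φ_l considered on the subset Λ₋₁⁽ˡ⁻¹⁾′∩Λ₅⁽ˡ⁾ᶜ of the L^{l−k}-lattice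
satisfy the inequalities |A_l(x_l)| ≦ O(1)L^{−(l−k)d/2}(1/(μ₀Lᵏε))p(Lᵏε), |φ_l(x_l)| ≦ O(1)L^{−(l−k)d/4}(1/λ(Lᵏε)^{1/4})p(Lᵏε), (3.15)
so we have |Φ′(x)| ≦ O(1)(1/(μ₀Lᵏε))p(Lᵏε) ≦ O(1)(Lᵏε)^{−2}, |Φ″(x)| ≦ O(1)(1/λ(Lᵏε)^{1/4})p(Lᵏε) ≦ O(1)(Lᵏε)^{−2} (3.16) for
x ∈ Λ₅⁽ᵏ⁾. Of course the above estimates are very rough, especially the second."*  p. 591 (3.39): *"(the expression {…} on the left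
side of (3.22)) ≦ Π_{k=0}^{K−1} ζ′_{Λ₀⁽ᵏ⁾} exp(E_{0,s}) exp(O(1) Σ_{k=0}^{K}|Λ_k|)."*  [B4] p. 574: *"let A satisfies the condition
|(∂^η_μA)(x)| ≤ O(1)p(e) … (1.21) … − O(1)e^{2−α}Σ_{x∈Ω⁽ᵏ⁾}|φ(x)|² (1.22)"*.

THE COUNT (r14, G-B2-07 (ix); pub-balaban G-pv07-1 (ii)).  (3.15) gives on `Λ_k` the sup-bound `|φ′_k| ≤ O(1)λ(Lᵏε)^{−1/4}p(Lᵏε)`,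
i.e. `Ψ_k²(Lᵏε)^d = O(1)λ^{−1/2}p²(Lᵏε)^{d/2}`; the (1.21)/(2.2) regularity gives `e²(Lᵏδ_k)² = O(1)e²p²(Lᵏε)^{2−d}`; the product is
`O(1)e²λ^{−1/2}p⁴(Lᵏε)^{2−d/2}`, so the error of the restricted (3.26) is `O((Lᵏε)^{κ₀′})|Λ_k|` with `κ₀′ = 2 − d/2 − η` (any
`η > 0`; below the (2.11) `κ₀`, which downstream never needs — (3.39) absorbs the error into `exp(O(1)Σ|Λ_k|)`).  HERE: the two
printed-shape bounds are HYPOTHESES (`hδA`, `hΨA`; their derivation from the characteristic functions of (3.21) — the regularity of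
the §3 field (3.2)–(3.4) on `Bᵏ(Λ_k)` — is the open item (d1) of G-B2-07 (ix)); PROVED are the arithmetic, the polylog-versus-power
absorption and the re-issue of (3.39).

WHAT IS PROVED (kernel-checked, 0 `sorry`, theorems only, standard axioms).
§1 (private `one_add_le_inv_mul_exp`: `1 + t ≤ c⁻¹e^{ct}`), **`pFn_pow_four_mul_sqrt_le`** (`p(ℓ)⁴√ℓ ≤ b₀⁴(8p)^{4p}`, `0 < ℓ ≤ 1`, `p ≥ 1/8`),
   (private `sq_div_sqrt_pow_le_sqrt`: `m²/√(m^d) ≤ √m`, `d ≤ 3`, `m ≤ 1`), **`errDensity_le_of_printed`** (printed-shape moduli ⇒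
   `16γ₀d³e²(Lᵏδ_k)²Ψ_k²(Lᵏε)^d ≤ 16γ₀d³·c_Ac_ΦC_p·e²`, uniform in `k`, `ε`).
§2 **`ineq339_regular_printedModuli`**: `B2Ineq339RegularFieldConcrete.ineq339_regular` with its `hdens` SUPPLIED by §1 — the printed
   (3.39) `((3.22)).toReal ≤ Π_{j<K}ζ′_j · e^{E_{0,s}} · e^{(½N log 2 + 16γ₀d³c_Ac_ΦC_pe²)Σ_{k=0}^{K}|Λ_k|}`.
HONEST SCOPE.  As in `B2Ineq335RegularFieldConcrete`/`B2Ineq339RegularFieldConcrete` (δ_k-regularity, smallness, sup-restrictions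
are p23's explicit reading of the (3.21) restrictions); this file only replaces the uniform bound `C₀` by printed-shape moduli
hypotheses and proves the count; `c_Φ` carries the printed `λ^{−1/2}`, `c_A` the `O(1)` of (1.21); `d ≤ 3` (the papers' `d = 2, 3`).
Value = the exponent bookkeeping of the §3.B error terms kernel-checked; NOT summit progress.
-/

noncomputable section

open MeasureTheory Finset Function Real
open scoped ENNReal BigOperators

namespace Literature.MathematicalPhysics.QuantumFieldTheory.Balaban1983to89.B2Ineq339RegularFieldModuli

open Literature.MathematicalPhysics.QuantumFieldTheory.Balaban1983to89.B2Ineq338Diamagnetic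
open Literature.MathematicalPhysics.QuantumFieldTheory.Balaban1983to89.B2Eq337ScalarIntegration
open Literature.MathematicalPhysics.QuantumFieldTheory.Balaban1983to89.B2Eq325ConcreteSchur
open Literature.MathematicalPhysics.QuantumFieldTheory.Balaban1983to89.B2Eq328ConcretePieces
open Literature.MathematicalPhysics.QuantumFieldTheory.Balaban1983to89.B2Ineq339Gathering
open Literature.MathematicalPhysics.QuantumFieldTheory.Balaban1983to89.B2Eq337LastIntegrations
open Literature.MathematicalPhysics.QuantumFieldTheory.Balaban1983to89.B2Ineq335Exceptions
open Literature.MathematicalPhysics.QuantumFieldTheory.Balaban1983to89.B2Ineq335Printed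
open Literature.MathematicalPhysics.QuantumFieldTheory.Balaban1983to89.B2Ineq335ZeroFieldConcrete
open Literature.MathematicalPhysics.QuantumFieldTheory.Balaban1983to89.B2Ineq335RegularFieldConcrete
open Literature.MathematicalPhysics.QuantumFieldTheory.Balaban1983to89.B2Ineq339RegularFieldConcrete

variable {P : HiggsLattice.Params} {N K : ℕ}

/-! ## §1  The exponent bookkeeping: printed-shape moduli `δ_k`, `Ψ_k` ⇒ the uniform error density of `ineq339_regular`

r14's count (cell GAPS G-B2-07 (ix), 2026-08-21): p. 586 (3.15) gives on `Λ_k` the sup-bound `|φ′_k| ≤ O(1)λ(Lᵏε)^{−1/4}p(Lᵏε)`,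
i.e. `Ψ_k²(Lᵏε)^d = O(1)λ^{−1/2}p²(Lᵏε)^{d/2}`, and the (1.21)/(2.2) regularity gives `e²(Lᵏδ_k)² = O(1)e²p²(Lᵏε)^{2−d}`; the
product is `O(1)e²λ^{−1/2}p⁴(Lᵏε)^{2−d/2}`, and for `d ≤ 3` the positive power `(Lᵏε)^{2−d/2} ≤ (Lᵏε)^{1/2}` absorbs the
polylogarithm `p(Lᵏε)⁴` (`p(ℓ) = b₀(1 + log ℓ⁻¹)ᵖ`, p. 557): the error density of the restricted Proposition 3.1 is UNIFORMLY
BOUNDED, which is all (3.39) needs (*"exp(O(1)Σ|Λ_k|)"*; any `κ₀ > 0` — here `κ₀′ = 2 − d/2 − η` — is immaterial downstream,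
pub-balaban GAPS G-pv07-1 CLARIFICATION).  The two printed-shape bounds stay HYPOTHESES (`hδ`, `hΨ`: their derivation from
the characteristic functions of (3.21) is the open item (d1) of G-B2-07 (ix)); proved here are the arithmetic and the
polylog-versus-power absorption, and `ineq339_regular` is re-issued with them (`ineq339_regular_printedModuli`). -/

section Bookkeeping

/-- `1 + t ≤ c⁻¹e^{ct}` for `0 < c ≤ 1` and every real `t` (from `1 + ct ≤ e^{ct}` and `c⁻¹ ≥ 1`). [folklore] -/
private theorem one_add_le_inv_mul_exp {c : ℝ} (t : ℝ) (hc : 0 < c) (hc1 : c ≤ 1) :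
    1 + t ≤ c⁻¹ * Real.exp (c * t) := by
  have h1 : c * t + 1 ≤ Real.exp (c * t) := Real.add_one_le_exp (c * t)
  have hci : c * c⁻¹ = 1 := mul_inv_cancel₀ hc.ne'
  have hcinv : 1 ≤ c⁻¹ := by nlinarith [inv_pos.2 hc]
  calc 1 + t ≤ c⁻¹ + t := by linarith
    _ = c⁻¹ * (c * t + 1) := by rw [mul_add, mul_one, ← mul_assoc, inv_mul_cancel₀ hc.ne', one_mul, add_comm]
    _ ≤ c⁻¹ * Real.exp (c * t) := mul_le_mul_of_nonneg_left h1 (inv_pos.2 hc).le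

/-- **Polylogarithm versus power**: `p(ℓ)⁴·√ℓ ≤ b₀⁴(8p)^{4p}` for `0 < ℓ ≤ 1`, `b₀ ≥ 0`, `p ≥ 1/8` (with `t = log ℓ⁻¹ ≥ 0`:
`(1 + t)^{4p} ≤ (8p)^{4p}e^{t/2}` and `√ℓ = e^{−t/2}`). [cite: Balaban1982Higgs2, p.557 (definition of p(ε))] -/
theorem pFn_pow_four_mul_sqrt_le {b₀ p ℓ : ℝ} (hb : 0 ≤ b₀) (hp : 1 / 8 ≤ p) (hℓ : 0 < ℓ) (hℓ1 : ℓ ≤ 1) :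
    B2.pFn b₀ p ℓ ^ 4 * Real.sqrt ℓ ≤ b₀ ^ 4 * (8 * p) ^ (4 * p) := by
  set t : ℝ := Real.log ℓ⁻¹ with ht
  have ht0 : 0 ≤ t := by
    rw [ht, Real.log_inv]
    have := Real.log_nonpos hℓ.le hℓ1
    linarith
  have h1t : 0 ≤ 1 + t := by linarith
  have h8p : 0 < 8 * p := by linarith
  -- `p(ℓ)⁴ = b₀⁴(1 + t)^{4p}`
  have hpow : B2.pFn b₀ p ℓ ^ 4 = b₀ ^ 4 * (1 + t) ^ (4 * p) := by
    unfold B2.pFn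
    rw [← ht, mul_pow]
    congr 1
    rw [← Real.rpow_natCast ((1 + t) ^ p) 4, ← Real.rpow_mul h1t]
    congr 1
    push_cast
    ring
  -- `√ℓ = e^{−t/2}`
  have hsqrt : Real.sqrt ℓ = Real.exp (-(t / 2)) := by
    have hℓt : ℓ = Real.exp (-(t / 2)) ^ 2 := by
      rw [← Real.exp_nat_mul]
      have : ((2 : ℕ) : ℝ) * -(t / 2) = Real.log ℓ := by
        rw [ht, Real.log_inv]; push_cast; ring
      rw [this, Real.exp_log hℓ]
    rw [hℓt, Real.sqrt_sq (Real.exp_pos _).le]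
  -- `(1 + t)^{4p} ≤ (8p)^{4p} e^{t/2}`
  have hc : 0 < (8 * p)⁻¹ := inv_pos.2 h8p
  have hc1 : (8 * p)⁻¹ ≤ 1 := inv_le_one_of_one_le₀ (by linarith)
  have hbase : 1 + t ≤ (8 * p) * Real.exp ((8 * p)⁻¹ * t) := by
    have h := one_add_le_inv_mul_exp t hc hc1
    rwa [inv_inv] at h
  have hrp : (1 + t) ^ (4 * p) ≤ (8 * p) ^ (4 * p) * Real.exp (t / 2) := by
    have h := Real.rpow_le_rpow h1t hbase (by linarith : 0 ≤ 4 * p)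
    rw [Real.mul_rpow h8p.le (Real.exp_pos _).le, ← Real.exp_mul] at h
    have e : (8 * p)⁻¹ * t * (4 * p) = t / 2 := by field_simp; ring
    rwa [e] at h
  rw [hpow, hsqrt, mul_assoc]
  refine mul_le_mul_of_nonneg_left ?_ (pow_nonneg hb 4)
  calc (1 + t) ^ (4 * p) * Real.exp (-(t / 2))
      ≤ (8 * p) ^ (4 * p) * Real.exp (t / 2) * Real.exp (-(t / 2)) :=
        mul_le_mul_of_nonneg_right hrp (Real.exp_pos _).le
    _ = (8 * p) ^ (4 * p) := by
        rw [mul_assoc, ← Real.exp_add, add_neg_cancel, Real.exp_zero, mul_one]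

/-- `m²/√(m^d) ≤ √m` for `0 < m ≤ 1`, `d ≤ 3` (`m⁴ ≤ m^{d+1}`): the power `(Lᵏε)^{2−d/2}` of the count is at least the half power.
[folklore] -/
private theorem sq_div_sqrt_pow_le_sqrt {m : ℝ} {d : ℕ} (hm : 0 < m) (hm1 : m ≤ 1) (hd : d ≤ 3) :
    m ^ 2 / Real.sqrt (m ^ d) ≤ Real.sqrt m := by
  have hmd : 0 < m ^ d := pow_pos hm d
  have h0 : 0 ≤ m ^ 2 / Real.sqrt (m ^ d) := by positivity
  have hsq : (m ^ 2 / Real.sqrt (m ^ d)) ^ 2 ≤ m := by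
    rw [div_pow, Real.sq_sqrt hmd.le, div_le_iff₀ hmd]
    calc (m ^ 2) ^ 2 = m ^ 4 := by ring
      _ ≤ m ^ (d + 1) := pow_le_pow_of_le_one hm.le hm1 (by omega)
      _ = m * m ^ d := by ring
  calc m ^ 2 / Real.sqrt (m ^ d) = Real.sqrt ((m ^ 2 / Real.sqrt (m ^ d)) ^ 2) := (Real.sqrt_sq h0).symm
    _ ≤ Real.sqrt m := Real.sqrt_le_sqrt hsq

variable (C : HiggsLattice.ChargeData N)

/-- **THE COUNT** (the error density of `ineq339_regular` from printed-shape moduli): if at scale `k = j+1` (`Lᵏε ≤ 1`, `d ≤ 3`)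
`e²(Lᵏδ_k)² ≤ c_A·e²p_k²·(Lᵏε)^{2−d}` ((1.21)/(2.2)-type regularity of `Ã^ε`) and `Ψ_k²(Lᵏε)^d ≤ c_Φ·p_k²·(Lᵏε)^{d/2}` ((3.15),
`c_Φ` carrying the `λ^{−1/2}`), and `p_k⁴·(Lᵏε)^{1/2} ≤ C_p` (e.g. `pFn_pow_four_mul_sqrt_le`), then
`16γ₀d³e²(Lᵏδ_k)²Ψ_k²(Lᵏε)^d ≤ 16γ₀d³·c_Ac_ΦC_p·e²` — a bound UNIFORM in `k`, `ε`. [cite: Balaban1982Higgs2, (3.39) p.591,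
(3.15)–(3.16) p.586, Prop. 3.1 (3.26) p.589] [cite: Balaban1983RegularityDecay, (1.21)–(1.22) p.574] -/
theorem errDensity_le_of_printed (hd : P.d ≤ 3) {γ₀ : ℝ} (hγ0 : 0 ≤ γ₀) (j : Fin K) (hmesh : P.mesh (j.val + 1) ≤ 1)
    {δj Ψj pk cA cΦ Cp : ℝ} (hcA : 0 ≤ cA) (hcΦ : 0 ≤ cΦ) (hpk : 0 ≤ pk)
    (hδ : C.e ^ 2 * (((P.L : ℝ) ^ (j.val + 1)) ^ 2 * δj ^ 2)
      ≤ cA * C.e ^ 2 * pk ^ 2 * (P.mesh (j.val + 1) ^ 2 / P.mesh (j.val + 1) ^ P.d))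
    (hΨ : Ψj ^ 2 * P.mesh (j.val + 1) ^ P.d ≤ cΦ * pk ^ 2 * Real.sqrt (P.mesh (j.val + 1) ^ P.d))
    (hp : pk ^ 4 * Real.sqrt (P.mesh (j.val + 1)) ≤ Cp) :
    16 * γ₀ * (P.d : ℝ) ^ 3 * C.e ^ 2 * ((P.L : ℝ) ^ (j.val + 1)) ^ 2 * δj ^ 2 * (Ψj ^ 2 * P.mesh (j.val + 1) ^ P.d)
      ≤ 16 * γ₀ * (P.d : ℝ) ^ 3 * (cA * cΦ * Cp * C.e ^ 2) := by
  set m : ℝ := P.mesh (j.val + 1) with hm_def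
  have hm : 0 < m := P.mesh_pos _
  have hmd : 0 < m ^ P.d := pow_pos hm _
  have hs : 0 < Real.sqrt (m ^ P.d) := Real.sqrt_pos.2 hmd
  -- the product of the two printed-shape bounds
  have hX : C.e ^ 2 * (((P.L : ℝ) ^ (j.val + 1)) ^ 2 * δj ^ 2) * (Ψj ^ 2 * m ^ P.d)
      ≤ (cA * C.e ^ 2 * pk ^ 2 * (m ^ 2 / m ^ P.d)) * (cΦ * pk ^ 2 * Real.sqrt (m ^ P.d)) :=
    mul_le_mul hδ hΨ (mul_nonneg (sq_nonneg _) (pow_nonneg hm.le _))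
      (by have := sq_nonneg C.e; positivity)
  -- the geometry of the exponents: `m²/m^d · √(m^d) = m²/√(m^d) ≤ √m`
  have hgeom : m ^ 2 / m ^ P.d * Real.sqrt (m ^ P.d) ≤ Real.sqrt m := by
    have e : m ^ 2 / m ^ P.d * Real.sqrt (m ^ P.d) = m ^ 2 / Real.sqrt (m ^ P.d) := by
      rw [div_mul_eq_mul_div, div_eq_div_iff hmd.ne' hs.ne', mul_assoc, Real.mul_self_sqrt hmd.le]
    rw [e]
    exact sq_div_sqrt_pow_le_sqrt hm hmesh hd
  have hY : (cA * C.e ^ 2 * pk ^ 2 * (m ^ 2 / m ^ P.d)) * (cΦ * pk ^ 2 * Real.sqrt (m ^ P.d))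
      = cA * cΦ * C.e ^ 2 * (pk ^ 4 * (m ^ 2 / m ^ P.d * Real.sqrt (m ^ P.d))) := by ring
  have hZ : pk ^ 4 * (m ^ 2 / m ^ P.d * Real.sqrt (m ^ P.d)) ≤ Cp :=
    le_trans (mul_le_mul_of_nonneg_left hgeom (pow_nonneg hpk 4)) hp
  have hcoef : 0 ≤ cA * cΦ * C.e ^ 2 := by
    have := sq_nonneg C.e
    positivity
  calc 16 * γ₀ * (P.d : ℝ) ^ 3 * C.e ^ 2 * ((P.L : ℝ) ^ (j.val + 1)) ^ 2 * δj ^ 2 * (Ψj ^ 2 * m ^ P.d)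
      = 16 * γ₀ * (P.d : ℝ) ^ 3 * (C.e ^ 2 * (((P.L : ℝ) ^ (j.val + 1)) ^ 2 * δj ^ 2) * (Ψj ^ 2 * m ^ P.d)) := by ring
    _ ≤ 16 * γ₀ * (P.d : ℝ) ^ 3 * ((cA * C.e ^ 2 * pk ^ 2 * (m ^ 2 / m ^ P.d)) * (cΦ * pk ^ 2 * Real.sqrt (m ^ P.d))) :=
        mul_le_mul_of_nonneg_left hX (by positivity)
    _ = 16 * γ₀ * (P.d : ℝ) ^ 3 * (cA * cΦ * C.e ^ 2 * (pk ^ 4 * (m ^ 2 / m ^ P.d * Real.sqrt (m ^ P.d)))) := by rw [hY]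
    _ ≤ 16 * γ₀ * (P.d : ℝ) ^ 3 * (cA * cΦ * C.e ^ 2 * Cp) :=
        mul_le_mul_of_nonneg_left (mul_le_mul_of_nonneg_left hZ hcoef) (by positivity)
    _ = 16 * γ₀ * (P.d : ℝ) ^ 3 * (cA * cΦ * Cp * C.e ^ 2) := by ring

end Bookkeeping

/-! ## §2  (3.39) at a regular `Ã^ε ≠ 0` from printed-shape moduli -/

section PrintedModuli

variable (R : Regions P K) (C : HiggsLattice.ChargeData N) (A : HiggsLattice.VecField P 0) {a msq : ℝ}
variable {O : ℕ → Type} [∀ i, Fintype (O i)] [∀ i, DecidableEq (O i)]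
variable {ι : Fin K → Type*} [∀ j, Fintype (ι j)]

/-- **(3.22) ⇒ (3.39) AT A REGULAR `Ã^ε ≠ 0` WITH THE ERROR COUNTED FROM PRINTED-SHAPE MODULI** (`d ≤ 3`): `ineq339_regular`
with its uniform error density SUPPLIED by `errDensity_le_of_printed` — hypotheses per scale `k = j+1`: the regularity modulus in
the (1.21)/(2.2) shape `e²(Lᵏδ_k)² ≤ c_A e²p_k²(Lᵏε)^{2−d}`, the sup-bound in the (3.15) shape `Ψ_k²(Lᵏε)^d ≤ c_Φp_k²(Lᵏε)^{d/2}`,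
and the polylog absorption `p_k⁴(Lᵏε)^{1/2} ≤ C_p` (for `p_k = p(Lᵏε)`: `pFn_pow_four_mul_sqrt_le`); conclusion: the printed (3.39)
`(3.22) ≤ Π_{j<K}ζ′_j · exp(E_{0,s}) · exp((½N log 2 + 16γ₀d³c_Ac_ΦC_pe²)·Σ_{k=0}^{K}|Λ_k|)`.
[cite: Balaban1982Higgs2, (3.39) p.591, (3.15)–(3.16) p.586, Prop. 3.1 (3.26) p.589] -/
theorem ineq339_regular_printedModuli (hR : Nested R) (hK : K ≤ P.K) (hε : P.mesh K ≤ 1) (ha : 0 < a) (hL : 1 < P.L)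
    (hmsq : 0 < msq) (hd : P.d ≤ 3) {δ : Fin K → ℝ} (hδ : ∀ j, 0 ≤ δ j)
    (hreg : ∀ (j : Fin K), ∀ z ∈ pieceF R j, ∀ μ' ν : Fin P.d, |A ⟨z.shift ν, μ'⟩ - A ⟨z, μ'⟩| ≤ δ j)
    (hsmall : ∀ j : Fin K, 8 * (P.d : ℝ) ^ 4 * (P.L : ℝ) ^ P.d * C.e ^ 2 * P.mesh (j.val + 1) ^ 2 *
      ((P.L : ℝ) ^ (j.val + 1)) ^ 2 * δ j ^ 2 ≤ 1 / 2)
    {γ₀ : ℝ} (hγ0 : 0 ≤ γ₀) (hγB : γ₀ * (8 * P.d + 2 * msq + 4) ≤ a * (1 - ((P.L : ℝ) ^ 2)⁻¹))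
    (hγ16 : γ₀ ≤ 1 / 16) (Ψ : Fin K → ℝ) {pk : Fin K → ℝ} {cA cΦ Cp : ℝ} (hcA : 0 ≤ cA) (hcΦ : 0 ≤ cΦ)
    (hCp : 0 ≤ Cp) (hpk : ∀ j, 0 ≤ pk j)
    (hδA : ∀ j : Fin K, C.e ^ 2 * (((P.L : ℝ) ^ (j.val + 1)) ^ 2 * δ j ^ 2)
      ≤ cA * C.e ^ 2 * pk j ^ 2 * (P.mesh (j.val + 1) ^ 2 / P.mesh (j.val + 1) ^ P.d))
    (hΨA : ∀ j : Fin K, Ψ j ^ 2 * P.mesh (j.val + 1) ^ P.d ≤ cΦ * pk j ^ 2 * Real.sqrt (P.mesh (j.val + 1) ^ P.d))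
    (hp : ∀ j : Fin K, pk j ^ 4 * Real.sqrt (P.mesh (j.val + 1)) ≤ Cp)
    {s : ℕ → ℝ} (hs : ∀ j, 0 < s j)
    {c : (j : ℕ) → ((i : ℕ) → Sites R O i → V N) → Sites R O (j + 1) → V N} (hc : ∀ j, Measurable (c j))
    (hcdep : ∀ j i, j + 1 ≤ i → ∀ (x : (i : ℕ) → Sites R O i → V N) (y : Sites R O i → V N),
      c j (update x i y) = c j x)
    {r : ℕ → ℝ} (hr : ∀ j, 4 * (N : ℝ) * Real.log 2 ≤ a * r j)
    {b : ((i : ℕ) → Sites R O i → V N) → ℝ} (hb : ∀ x, 0 ≤ b x ∧ b x ≤ 1)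
    (hrestr : ∀ x, b x ≠ 0 → ∀ (j : Fin K) (y : LSite R j), ‖resL R j (cfgOf R (x 0)) y‖ ≤ Ψ j)
    (w : (j : Fin K) → ι j → ℝ) (hw : ∀ j τ, 0 ≤ w j τ)
    (Q : (j : Fin K) → ι j → Finset (Bnd P)) (hQ : ∀ j τ, Q j τ ⊆ bondSet R j)
    (Pex : (j : Fin K) → ι j → Finset (Sites R O (j + 1)))
    (χQ : (j : Fin K) → ι j → (KSite R → V N) → ℝ) (hχ : ∀ j τ u, χQ j τ u = 0 ∨ χQ j τ u = 1)
    (hlarge : ∀ j τ u, χQ j τ u = 1 → ∀ bb ∈ Q j τ, r j < bondTermA R C A u bb)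
    (x : (i : ℕ) → Sites R O i → V N) :
    (rhs322 (fun i => (volume : Measure (Sites R O i → V N)))
        (fun u => ENNReal.ofReal (Z325 R C a A msq * Real.exp (-(form325 R C a A msq (cfgOf R u) / 2))))
        (fun x => ENNReal.ofReal (b x))
        (gaussLevel (fun j _ => a * s j) c) (fun j τ => ENNReal.ofReal (w j τ))
        (fun j τ u => ENNReal.ofReal (χQ j τ u))
        (fun j τ => excLevel c j (largeFieldSite (Pex j τ) (s j) (r j))) x).toReal
      ≤ (∏ j : Fin K, ∑ τ : ι j, w j τ * Real.exp (-(γ₀ * r j * (Q j τ).card / 4))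
            * Real.exp (-(a * r j / 8)) ^ (Pex j τ).card)
        * Real.exp (E0s P C msq)
        * Real.exp (((N : ℝ) * Real.log 2 / 2 + 16 * γ₀ * (P.d : ℝ) ^ 3 * (cA * cΦ * Cp * C.e ^ 2))
            * ∑ k ∈ Finset.range (K + 1), vol R k) := by
  have hC₀ : 0 ≤ 16 * γ₀ * (P.d : ℝ) ^ 3 * (cA * cΦ * Cp * C.e ^ 2) := by
    have := sq_nonneg C.e
    positivity
  exact ineq339_regular R C A hR hK hε ha hL hmsq hδ hreg hsmall hγ0 hγB hγ16 Ψ hC₀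
    (fun j => errDensity_le_of_printed C hd hγ0 j ((B2Prop31ZeroFieldConcrete.mesh_le_mesh (Nat.succ_le_of_lt j.isLt)).trans hε)
      hcA hcΦ (hpk j) (hδA j) (hΨA j) (hp j))
    hs hc hcdep hr hb hrestr w hw Q hQ Pex χQ hχ hlarge x

end PrintedModuli

end Literature.MathematicalPhysics.QuantumFieldTheory.Balaban1983to89.B2Ineq339RegularFieldModuli

end
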